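import Mathlib
import Summits.Parity.BatemanHorn.Theses.PolynomialMobius
import Summits.Parity.BatemanHorn.Theorems.PolynomialMobiusPolyMobiusTailStubPairCornerOneSided
import Summits.Parity.BatemanHorn.Theorems.PolynomialMobiusPolyMobiusTailStubPairSwapCount
import Literature.NumberTheory.Sieve.LinearPairMoebiusMainTerm
import HarnessLib

/-!
# Crux `PolyMobiusTail` (stmt-Parity-0870), line `eta-free-multilinear-window`:
# stub `stub_pair_corner` — the CORNER `min(d₀, d₁) ≤ x^σ` of the linear pair window (S1b-P1)

For a Bateman–Horn system `f : Fin 2 → ℤ[X]` with both members of degree `≤ 1` and `0 < σ < 1/3`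
there is `c > 0` such that for all `θ, η ∈ (0, c]`

  `Σ_{n ≤ x} Σ_{d₀ ∣ f₀(n), d₁ ∣ f₁(n), x^{1-η} < d₀d₁ ≤ x^{1+θ}, min(d₀,d₁) ≤ x^σ} μ(d₀) log d₀ · μ(d₁) log d₁ = o(x)`.

We take `c = (1 - 3σ)/4`.

* The members are `qᵢ X + aᵢ` with `qᵢ ≥ 1`, `gcd(qᵢ, aᵢ) = 1` (a common prime would be a fixed prime
  divisor) and `q₁ a₀ - q₀ a₁ ≠ 0` (non-associated members): the `PairLinear.*` API of
  `PolynomialMobiusPolyMobiusTailStubPairSwapCount.lean`.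
* Since `2σ ≤ 1 - η`, the conditions `d₀ ≤ x^σ` and `d₁ ≤ x^σ` are mutually exclusive in the window
  (`PairCorner.ite_min_eq_add`), so for `x ≥ 1` the sum is the sum of the two ONE-SIDED corners
  (`Literature.NumberTheory.Sieve.LinearPairMoebius.sum_piFinset_two`, `Fin.prod_univ_two`), each of
  which is `o(x)` by the aux stub
  `stub_pair_corner_oneSided` (divisor switch `(d_min, m = f_other(n)/d_other)`, Bombieri–Vinogradov for
  `μ` — `Literature.NumberTheory.Sieve.bombieriVinogradov_moebius` — over the moduli `q d_min ≤ q x^σ` at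
  height `f_other(x)/m ≥ x^{1-σ-η}`, level `3σ + η < 1`; bounded-index non-reduced classes; partial
  summation for the `log`).
-/


open scoped BigOperators
open Filter Finset Polynomial Asymptotics

namespace Summit.Parity.BatemanHorn.Theorems.PolyMobiusTail.EtaFreeWindow

open Literature.NumberTheory.Sieve

namespace PairCorner

/-- The summand of the pair window with `min(a, b) ≤ x^σ` splits into the two one-sided summands once
`x^{2σ} ≤ x^{1-η}`: both `a, b ≤ x^σ` is incompatible with `x^{1-η} < a b`. [folklore] -/
theorem ite_min_eq_add {x : ℕ} {σ η θ : ℝ} (h2σ : (x : ℝ) ^ σ * (x : ℝ) ^ σ ≤ (x : ℝ) ^ (1 - η))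
    (hxσ : 0 ≤ (x : ℝ) ^ σ) (a b : ℕ) (V : ℝ) :
    (if (x : ℝ) ^ (1 - η) < (a : ℝ) * (b : ℝ) ∧ (a : ℝ) * (b : ℝ) ≤ (x : ℝ) ^ (1 + θ) ∧
        ((min a b : ℕ) : ℝ) ≤ (x : ℝ) ^ σ then V else 0) =
      (if (x : ℝ) ^ (1 - η) < (a : ℝ) * (b : ℝ) ∧ (a : ℝ) * (b : ℝ) ≤ (x : ℝ) ^ (1 + θ) ∧
          (a : ℝ) ≤ (x : ℝ) ^ σ then V else 0) +
      (if (x : ℝ) ^ (1 - η) < (b : ℝ) * (a : ℝ) ∧ (b : ℝ) * (a : ℝ) ≤ (x : ℝ) ^ (1 + θ) ∧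
          (b : ℝ) ≤ (x : ℝ) ^ σ then V else 0) := by
  have hmin : (((min a b : ℕ) : ℝ)) ≤ (x : ℝ) ^ σ ↔ (a : ℝ) ≤ (x : ℝ) ^ σ ∨ (b : ℝ) ≤ (x : ℝ) ^ σ := by
    rw [Nat.cast_min, min_le_iff]
  have hba : (b : ℝ) * (a : ℝ) = (a : ℝ) * (b : ℝ) := mul_comm _ _
  rw [hba]
  by_cases hW : (x : ℝ) ^ (1 - η) < (a : ℝ) * (b : ℝ) ∧ (a : ℝ) * (b : ℝ) ≤ (x : ℝ) ^ (1 + θ)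
  · have hnot : ¬ ((a : ℝ) ≤ (x : ℝ) ^ σ ∧ (b : ℝ) ≤ (x : ℝ) ^ σ) := by
      rintro ⟨ha, hb⟩
      have : (a : ℝ) * (b : ℝ) ≤ (x : ℝ) ^ σ * (x : ℝ) ^ σ :=
        mul_le_mul ha hb (Nat.cast_nonneg b) hxσ
      linarith [hW.1]
    by_cases ha : (a : ℝ) ≤ (x : ℝ) ^ σ
    · have hb : ¬ (b : ℝ) ≤ (x : ℝ) ^ σ := fun hb => hnot ⟨ha, hb⟩
      rw [if_pos ⟨hW.1, hW.2, hmin.2 (Or.inl ha)⟩, if_pos ⟨hW.1, hW.2, ha⟩,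
        if_neg (fun h => hb h.2.2), add_zero]
    · by_cases hb : (b : ℝ) ≤ (x : ℝ) ^ σ
      · rw [if_pos ⟨hW.1, hW.2, hmin.2 (Or.inr hb)⟩, if_neg (fun h => ha h.2.2),
          if_pos ⟨hW.1, hW.2, hb⟩, zero_add]
      · rw [if_neg (fun h => (hmin.1 h.2.2).elim ha hb), if_neg (fun h => ha h.2.2),
          if_neg (fun h => hb h.2.2), add_zero]
  · rw [if_neg (fun h => hW ⟨h.1, h.2.1⟩), if_neg (fun h => hW ⟨h.1, h.2.1⟩),
      if_neg (fun h => hW ⟨h.1, h.2.1⟩), add_zero]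

end PairCorner

/-- **Stub `stub_pair_corner` (S1b-P1, line `eta-free-multilinear-window`): the CORNER of the linear pair
window.**  For a Bateman–Horn pair `f = (f₀, f₁)` of degree `≤ 1` and `0 < σ < 1/3` there is `c > 0`
(`c = (1 - 3σ)/4`) such that for all `θ, η ∈ (0, c]` the part of the window `x^{1-η} < d₀ d₁ ≤ x^{1+θ}`
with `min(d₀, d₁) ≤ x^σ` of the Möbius tail `Σ_n Σ_{dᵢ ∣ fᵢ(n)} ∏ μ(dᵢ) log dᵢ` is `o(x)`.
Proof: the members are `qᵢ X + aᵢ` with `qᵢ ≥ 1`, `gcd(qᵢ, aᵢ) = 1` (no fixed prime divisor) and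
`q₁ a₀ - q₀ a₁ ≠ 0` (non-associated); since `2σ ≤ 1 - η` the conditions `d₀ ≤ x^σ`, `d₁ ≤ x^σ` are
exclusive in the window, so the sum is the sum of the two ONE-SIDED corners, each `o(x)` by
`stub_pair_corner_oneSided` — the divisor switch `(d_min, m = f_other(n)/d_other)`, Bombieri–Vinogradov
for `μ` (`Literature.NumberTheory.Sieve.bombieriVinogradov_moebius`) over the moduli `q d_min ≤ q x^σ` at
height `f_other(x)/m ≥ x^{1-σ-η}` (level `3σ + η < 1`), non-reduced classes of bounded index and partial
summation for the `log`. [folklore] -/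
theorem stub_pair_corner : ∀ (f : Fin 2 → ℤ[X]), IsBatemanHornSystem f → (∀ i, (f i).natDegree ≤ 1) →
    ∀ σ : ℝ, 0 < σ → σ < 1 / 3 →
    ∃ c : ℝ, 0 < c ∧ ∀ θ η : ℝ, 0 < θ → θ ≤ c → 0 < η → η ≤ c →
      (fun x : ℕ => ∑ n ∈ Finset.Icc 1 x,
        ∑ d ∈ Fintype.piFinset (fun i => (((f i).eval (n : ℤ)).toNat).divisors),
          if (x : ℝ) ^ (1 - η) < ∏ i, (d i : ℝ) ∧ ∏ i, (d i : ℝ) ≤ (x : ℝ) ^ (1 + θ) ∧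
              ((min (d 0) (d 1) : ℕ) : ℝ) ≤ (x : ℝ) ^ σ then
            ∏ i, ((ArithmeticFunction.moebius (d i) : ℝ) * Real.log (d i)) else 0)
        =o[atTop] fun x : ℕ => (x : ℝ) := by
  intro f hf hlin σ hσ0 hσ3
  refine ⟨(1 - 3 * σ) / 4, by linarith, fun θ η _ _ hη hηc => ?_⟩
  -- the two linear members `qᵢ X + aᵢ` (`PairLinear.*`)
  have hdeg : ∀ i, (f i).natDegree = 1 := PairLinear.natDegree_eq_one hf hlin
  set q₀ : ℕ := ((f 0).leadingCoeff).toNat with hq₀def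
  set q₁ : ℕ := ((f 1).leadingCoeff).toNat with hq₁def
  set a₀ : ℤ := (f 0).coeff 0 with ha₀def
  set a₁ : ℤ := (f 1).coeff 0 with ha₁def
  have hlc0 : 0 < (f 0).leadingCoeff := hf.leadingCoeff_pos 0
  have hlc1 : 0 < (f 1).leadingCoeff := hf.leadingCoeff_pos 1
  have hq₀z : ((q₀ : ℕ) : ℤ) = (f 0).leadingCoeff := Int.toNat_of_nonneg hlc0.le
  have hq₁z : ((q₁ : ℕ) : ℤ) = (f 1).leadingCoeff := Int.toNat_of_nonneg hlc1.le
  have hq₀ : 0 < q₀ := by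
    rcases Nat.eq_zero_or_pos q₀ with h | h
    · rw [h] at hq₀z; simp at hq₀z; linarith
    · exact h
  have hq₁ : 0 < q₁ := by
    rcases Nat.eq_zero_or_pos q₁ with h | h
    · rw [h] at hq₁z; simp at hq₁z; linarith
    · exact h
  have hev0 : ∀ n : ℕ, (f 0).eval (n : ℤ) = (q₀ : ℤ) * n + a₀ := fun n => by
    rw [PairLinear.eval_eq (hdeg 0), hq₀z]
  have hev1 : ∀ n : ℕ, (f 1).eval (n : ℤ) = (q₁ : ℤ) * n + a₁ := fun n => by
    rw [PairLinear.eval_eq (hdeg 1), hq₁z]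
  have hcop0 : Int.gcd (q₀ : ℤ) a₀ = 1 := by
    rw [hq₀z]
    exact Int.isCoprime_iff_gcd_eq_one.1 (PairLinear.isCoprime_leadingCoeff_coeff_zero hf (hdeg 0))
  have hcop1 : Int.gcd (q₁ : ℤ) a₁ = 1 := by
    rw [hq₁z]
    exact Int.isCoprime_iff_gcd_eq_one.1 (PairLinear.isCoprime_leadingCoeff_coeff_zero hf (hdeg 1))
  -- the resultant `q₁ a₀ - q₀ a₁ ≠ 0` (non-associated members)
  have hΔ : (q₁ : ℤ) * a₀ - (q₀ : ℤ) * a₁ ≠ 0 := by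
    rw [hq₀z, hq₁z]
    exact PairLinear.resultant_ne_zero hf hdeg
  -- the two one-sided corners are `o(x)`
  have h3 : 3 * σ + η < 1 := by linarith
  have hT₀ := stub_pair_corner_oneSided q₀ q₁ a₀ a₁ hq₀ hq₁ hcop1 hΔ σ η θ hσ0 hη h3
  have hΔ' : (q₀ : ℤ) * a₁ - (q₁ : ℤ) * a₀ ≠ 0 := fun h => hΔ (by linarith)
  have hT₁ := stub_pair_corner_oneSided q₁ q₀ a₁ a₀ hq₁ hq₀ hcop0 hΔ' σ η θ hσ0 hη h3
  refine (hT₀.add hT₁).congr' ?_ EventuallyEq.rfl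
  filter_upwards [eventually_ge_atTop 1] with x hx
  have hx1 : (1 : ℝ) ≤ x := by exact_mod_cast hx
  have hx0 : (0 : ℝ) < x := by linarith
  have hxσ : 0 ≤ (x : ℝ) ^ σ := Real.rpow_nonneg hx0.le σ
  have h2σ : (x : ℝ) ^ σ * (x : ℝ) ^ σ ≤ (x : ℝ) ^ (1 - η) := by
    rw [← Real.rpow_add hx0]
    exact Real.rpow_le_rpow_of_exponent_le hx1 (by linarith)
  symm
  calc (∑ n ∈ Finset.Icc 1 x,
        ∑ d ∈ Fintype.piFinset (fun i => (((f i).eval (n : ℤ)).toNat).divisors),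
          if (x : ℝ) ^ (1 - η) < ∏ i, (d i : ℝ) ∧ ∏ i, (d i : ℝ) ≤ (x : ℝ) ^ (1 + θ) ∧
              ((min (d 0) (d 1) : ℕ) : ℝ) ≤ (x : ℝ) ^ σ then
            ∏ i, ((ArithmeticFunction.moebius (d i) : ℝ) * Real.log (d i)) else 0)
      = ∑ n ∈ Finset.Icc 1 x, ∑ a ∈ (((f 0).eval (n : ℤ)).toNat).divisors, ∑ b ∈ (((f 1).eval (n : ℤ)).toNat).divisors,
          (if ((x : ℝ) ^ (1 - η) < (a : ℝ) * (b : ℝ) ∧ (a : ℝ) * (b : ℝ) ≤ (x : ℝ) ^ (1 + θ) ∧ ((min a b : ℕ) : ℝ) ≤ (x : ℝ) ^ σ) then (ArithmeticFunction.moebius a : ℝ) * Real.log a * ((ArithmeticFunction.moebius b : ℝ) * Real.log b) else 0) := by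
        refine Finset.sum_congr rfl fun n _ => ?_
        rw [LinearPairMoebius.sum_piFinset_two]
        simp only [Fin.prod_univ_two, Matrix.cons_val_zero, Matrix.cons_val_one]
    _ = ∑ n ∈ Finset.Icc 1 x, ∑ a ∈ (((f 0).eval (n : ℤ)).toNat).divisors, ∑ b ∈ (((f 1).eval (n : ℤ)).toNat).divisors,
          ((if ((x : ℝ) ^ (1 - η) < (a : ℝ) * (b : ℝ) ∧ (a : ℝ) * (b : ℝ) ≤ (x : ℝ) ^ (1 + θ) ∧ (a : ℝ) ≤ (x : ℝ) ^ σ) then (ArithmeticFunction.moebius a : ℝ) * Real.log a * ((ArithmeticFunction.moebius b : ℝ) * Real.log b) else 0) + (if ((x : ℝ) ^ (1 - η) < (b : ℝ) * (a : ℝ) ∧ (b : ℝ) * (a : ℝ) ≤ (x : ℝ) ^ (1 + θ) ∧ (b : ℝ) ≤ (x : ℝ) ^ σ) then (ArithmeticFunction.moebius a : ℝ) * Real.log a * ((ArithmeticFunction.moebius b : ℝ) * Real.log b) else 0)) := by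
        refine Finset.sum_congr rfl fun n _ => Finset.sum_congr rfl fun a _ =>
          Finset.sum_congr rfl fun b _ => ?_
        exact PairCorner.ite_min_eq_add h2σ hxσ a b _
    _ = (∑ n ∈ Finset.Icc 1 x, ∑ a ∈ (((f 0).eval (n : ℤ)).toNat).divisors, ∑ b ∈ (((f 1).eval (n : ℤ)).toNat).divisors,
          (if ((x : ℝ) ^ (1 - η) < (a : ℝ) * (b : ℝ) ∧ (a : ℝ) * (b : ℝ) ≤ (x : ℝ) ^ (1 + θ) ∧ (a : ℝ) ≤ (x : ℝ) ^ σ) then (ArithmeticFunction.moebius a : ℝ) * Real.log a * ((ArithmeticFunction.moebius b : ℝ) * Real.log b) else 0)) +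
        ∑ n ∈ Finset.Icc 1 x, ∑ a ∈ (((f 0).eval (n : ℤ)).toNat).divisors, ∑ b ∈ (((f 1).eval (n : ℤ)).toNat).divisors,
          (if ((x : ℝ) ^ (1 - η) < (b : ℝ) * (a : ℝ) ∧ (b : ℝ) * (a : ℝ) ≤ (x : ℝ) ^ (1 + θ) ∧ (b : ℝ) ≤ (x : ℝ) ^ σ) then (ArithmeticFunction.moebius a : ℝ) * Real.log a * ((ArithmeticFunction.moebius b : ℝ) * Real.log b) else 0) := by
        rw [← Finset.sum_add_distrib]
        refine Finset.sum_congr rfl fun n _ => ?_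
        rw [← Finset.sum_add_distrib]
        refine Finset.sum_congr rfl fun a _ => ?_
        rw [← Finset.sum_add_distrib]
    _ = (∑ n ∈ Finset.Icc 1 x, ∑ d ∈ (((q₀ : ℤ) * n + a₀).toNat).divisors, ∑ b ∈ (((q₁ : ℤ) * n + a₁).toNat).divisors, (if ((x : ℝ) ^ (1 - η) < (d : ℝ) * (b : ℝ) ∧ (d : ℝ) * (b : ℝ) ≤ (x : ℝ) ^ (1 + θ) ∧ (d : ℝ) ≤ (x : ℝ) ^ σ) then (ArithmeticFunction.moebius d : ℝ) * Real.log d * ((ArithmeticFunction.moebius b : ℝ) * Real.log b) else 0)) + (∑ n ∈ Finset.Icc 1 x, ∑ d ∈ (((q₁ : ℤ) * n + a₁).toNat).divisors, ∑ b ∈ (((q₀ : ℤ) * n + a₀).toNat).divisors, (if ((x : ℝ) ^ (1 - η) < (d : ℝ) * (b : ℝ) ∧ (d : ℝ) * (b : ℝ) ≤ (x : ℝ) ^ (1 + θ) ∧ (d : ℝ) ≤ (x : ℝ) ^ σ) then (ArithmeticFunction.moebius d : ℝ) * Real.log d * ((ArithmeticFunction.moebius b : ℝ) * Real.log b) else 0))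 := by
        congr 1
        · refine Finset.sum_congr rfl fun n _ => ?_
          rw [hev0 n, hev1 n]
        · refine Finset.sum_congr rfl fun n _ => ?_
          rw [hev0 n, hev1 n, Finset.sum_comm]
          refine Finset.sum_congr rfl fun d _ => Finset.sum_congr rfl fun b _ => ?_
          split_ifs <;> ring

end Summit.Parity.BatemanHorn.Theorems.PolyMobiusTail.EtaFreeWindow
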